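import Mathlib
import Literature.Computability.Complexity.CircuitClasses
import Literature.Computability.Complexity.CircuitComposition
import Literature.Computability.Complexity.FormulaComposition
import Literature.Computability.MetaComplexity.Magnification
import HarnessLib

/-!
# Almost-everywhere circuit-family classes: `SIZEae s`, leaf-size De Morgan formulas `FORMULAae s`,
# and probabilistic formulas `PFORMULAae ε s` (Chen–Jin–Williams 2020, Def. 1.1)

Vocabulary file (definitions + folklore API, no named facts) for the hardness-magnification census
(`OliveiraPichSanthanam2019/`, `ChenJinWilliams2020/`, `MagnificationFrontiersAE.lean`).

## Why almost-everywhere classes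

The tree's `SIZE s` / `FORMULA s` (`CircuitClasses.lean`, `Magnification.lean`) impose the size bound
at EVERY input length. Two accidents follow: (1) `FORMULA s = ∅` for every `s`
(`FORMULA_eq_empty`: the De Morgan basis `{∧₂, ∨₂, ¬}` has no constants, so there is no De Morgan
circuit on the empty input type `Fin 0`), which made the vendored frontier facts `chop_frontierB4/C4`
vacuous; (2) more generally `L ∉ CLASS[s]` for an every-length class only says that at ONE length the
slice of `L` needs more than `s` gates, so small-length accidents (`s 1 = 1`, …) can make a
"lower-bound hypothesis" provable for silly reasons — fatal when the hypothesis is the antecedent of a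
vendored magnification theorem. The classes below impose the structural and size constraints only for
all sufficiently large lengths (`∃ n₀, ∀ n ≥ n₀`), while the family must decide the language at every
length. Then `L ∉ SIZEae s` says: every circuit family deciding `L` violates the bound at infinitely
many lengths, i.e. for infinitely many `n` the slice `L ∩ {0,1}ⁿ` has circuit complexity `> s n` — the
literal reading of "`L ∉ Circuit[s]`" / "`L` does not have `s`-size circuits" in the sources
(Oliveira–Pich–Santhanam, ToC 17(11) 2021, §1.2 "Notation", p. 4; Chen–Jin–Williams, STOC 2020, §1,
Def. 1.1 and §2.1). Membership is insensitive to finitely many lengths (`FamilyAE.congr_eventually`,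
`PFamilyAE.congr_eventually`), which is what makes vendored statements robust to the papers' side
conditions "for each `n ≥ 1`" (OPS Def. 2.4) and to roundings at small lengths.

## Size measures

* `SIZEae s`: circuits over the full binary basis `B₂` (all gates of fan-in `≤ 2`), size = number of
  gates — OPS 2021, p. 4: *"Circuit[s] denotes fan-in two boolean circuits of size s and of unbounded
  depth (gate types do not matter in our results: our results hold for every fixed choice of basis for
  the gates …) … where size is measured by number of gates."*
* `FORMULAae s`: De Morgan formulas (`IsOver deMorganBasis`, fan-out `≤ 1` = `IsFormula`) of LEAF
  size `≤ s n` (`Circuit.leafSize` = number of argument slots wired to input variables, plus one if the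
  output wire is itself an input variable) — CJW 2020, §2.1: *"We consider De Morgan formulas (i.e.
  formulas with AND, OR, NOT gates). The size of a formula F, denoted by L(F), is the number of leaves
  in F."*; OPS 2021, p. 4: *"formulas of size at most s (measured by the number of leaves)"*. Negation
  gates are free in this measure, so it does not matter whether negations sit at the leaves.
* `PFORMULAae ε s`: PROBABILISTIC formulas — CJW 2020, Def. 1.1: *"A probabilistic formula is a
  distribution 𝓕 over De Morgan formulas. We say 𝓕 computes a function f, if for all x,
  Pr_{F∼𝓕}[F(x) = f(x)] ≥ 2/3."*, with *"each formula F in its support satisfies L(F) ≤ s"* (proof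
  of Thm. 5.5) — rendered with Mathlib's `PMF`, one distribution per input length, the ERROR bound
  `ε n` an explicit parameter of the class (CJW: `ε = 1/3`; other sources use `n`-dependent errors),
  the leaf-size and basis constraints on every formula in the support (for all large `n`).

## Non-vacuity

`headLang` (strings whose first bit is `1`) lies in `SIZEae s` for every `s`, in `FORMULAae s` and
`PFORMULAae ε s` as soon as `1 ≤ s n` eventually (`headLang_mem_*`); deterministic classes embed in the
probabilistic ones (`FamilyAE_subset_PFamilyAE`, Dirac distributions); `SIZE s ⊆ SIZEae s`.
-/

noncomputable section

open scoped ENNReal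

namespace Literature.Computability.MetaComplexity

open Literature.Computability.Complexity

/-! ### Leaf size -/

/-- The **leaf size** of a circuit: the number of argument slots (over all gates) wired directly to an
input variable, plus `1` if the output wire is itself an input variable (the one-leaf formula `xᵢ`).
For a formula (fan-out `≤ 1`) this is the number of leaves of the formula tree, the size measure of
Chen–Jin–Williams 2020, §2.1 (*"The size of a formula F, denoted by L(F), is the number of leaves in
F"*) and of `U₂/B₂-Formula[s]` in Oliveira–Pich–Santhanam 2021, p. 4. Deliberate dot-notation
extension of the `Complexity.Circuit` structure from the `MetaComplexity` directory.
[cite: ChenJinWilliams2020, §2.1 (formula size = number of leaves)] -/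
def _root_.Literature.Computability.Complexity.Circuit.leafSize {ι : Type*} (C : Circuit ι) : ℕ :=
  (C.gates.map fun g => (List.ofFn g.args).countP fun w => w.isLeft).sum +
    (if C.output.isLeft then 1 else 0)

/-- The one-leaf formula `xᵢ` has leaf size `1`. [folklore] -/
@[simp] theorem leafSize_input {ι : Type*} (i : ι) : (Circuit.input i : Circuit ι).leafSize = 1 := by
  simp [Circuit.leafSize, Circuit.input]

/-- The constant circuit (one arity-`0` gate) has leaf size `0`. [folklore] -/
@[simp] theorem leafSize_const (ι : Type*) (b : Bool) : (Circuit.const ι b).leafSize = 0 := by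
  simp [Circuit.leafSize, Circuit.const]

/-! ### Deterministic almost-everywhere families -/

/-- **`FamilyAE P`**: languages decided (at every length) by a circuit family `C` whose members
satisfy the constraint `P n (C n)` for all sufficiently large `n`. The generic almost-everywhere
family class; `SIZEae`, `FORMULAae` are instances. [folklore] -/
def FamilyAE (P : ∀ n : ℕ, Circuit (Fin n) → Prop) : Set (Language Bool) :=
  {L | ∃ C : CircuitFamily, (∃ n₀ : ℕ, ∀ n ≥ n₀, P n (C n)) ∧ C.Decides L}

/-- **`SIZEae s`** (`Circuit[s]` of OPS 2021, p. 4, read almost everywhere): languages decided by a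
family of `B₂`-circuits with at most `s n` gates at every sufficiently large length `n`.
[cite: OliveiraPichSanthanam2021, §1.2 (Notation, p. 4: Circuit[s])] -/
def SIZEae (s : ℕ → ℕ) : Set (Language Bool) :=
  FamilyAE fun n C => C.IsOver B2 ∧ C.size ≤ s n

/-- **`FORMULAae s`** (`Formula[s]`, De Morgan formulas of leaf size `≤ s`, read almost everywhere):
languages decided by a family of De Morgan formulas (`{∧₂, ∨₂, ¬}`, fan-out `≤ 1`) of leaf size
`≤ s n` at every sufficiently large length. [cite: ChenJinWilliams2020, §2.1 (De Morgan formulas, size = leaves)] -/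
def FORMULAae (s : ℕ → ℕ) : Set (Language Bool) :=
  FamilyAE fun n C => C.IsOver deMorganBasis ∧ C.IsFormula ∧ C.leafSize ≤ s n

/-! ### Probabilistic almost-everywhere families -/

/-- **`PFamilyAE ε P`**: languages `L` computed with error `≤ ε n` by a family of DISTRIBUTIONS
`F n` over `n`-input circuits — for every string `x`, `Pr_{C ∼ F |x|}[C(x) ≠ L(x)] ≤ ε |x|` — such
that for all sufficiently large `n` every circuit in the support of `F n` satisfies `P n`. With
`ε = 1/3` and `P` = "De Morgan formula of leaf size `≤ s n`" this is Chen–Jin–Williams's notion of an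
`s`-size probabilistic formula computing `L` (Def. 1.1: *"for all x, Pr_{F∼𝓕}[F(x) = f(x)] ≥ 2/3"*;
support-wise size bound as in the proof of their Thm. 5.5). The error is an explicit parameter.
[cite: ChenJinWilliams2020, Def. 1.1] -/
def PFamilyAE (ε : ℕ → ℝ≥0∞) (P : ∀ n : ℕ, Circuit (Fin n) → Prop) : Set (Language Bool) :=
  {L | ∃ F : (n : ℕ) → PMF (Circuit (Fin n)),
    (∃ n₀ : ℕ, ∀ n ≥ n₀, ∀ C ∈ (F n).support, P n C) ∧
    ∀ x : List Bool,
      (F x.length).toOuterMeasure {C | C.eval x.get ≠ L.boolIndicator x} ≤ ε x.length}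

/-- **`PFORMULAae ε s`**: languages computed with error `≤ ε n` by probabilistic De Morgan formulas
all of whose supported formulas have leaf size `≤ s n` (for all large `n`) — "`L` has `s`-size
probabilistic formulas" of Chen–Jin–Williams 2020 (Def. 1.1, `ε = 1/3`). [cite: ChenJinWilliams2020, Def. 1.1] -/
def PFORMULAae (ε : ℕ → ℝ≥0∞) (s : ℕ → ℕ) : Set (Language Bool) :=
  PFamilyAE ε fun n C => C.IsOver deMorganBasis ∧ C.IsFormula ∧ C.leafSize ≤ s n

/-! ### Monotonicity and inclusions -/

/-- `FamilyAE` is monotone in the constraint (eventual implication suffices). [folklore] -/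
theorem FamilyAE_mono {P Q : ∀ n : ℕ, Circuit (Fin n) → Prop}
    (h : ∃ n₁ : ℕ, ∀ n ≥ n₁, ∀ C, P n C → Q n C) : FamilyAE P ⊆ FamilyAE Q := by
  rintro L ⟨C, ⟨n₀, hn₀⟩, hL⟩
  obtain ⟨n₁, hn₁⟩ := h
  exact ⟨C, ⟨max n₀ n₁, fun n hn => hn₁ n (le_of_max_le_right hn) _ (hn₀ n (le_of_max_le_left hn))⟩,
    hL⟩

/-- `PFamilyAE` is monotone in the constraint (eventually) and in the error. [folklore] -/
theorem PFamilyAE_mono {ε ε' : ℕ → ℝ≥0∞} {P Q : ∀ n : ℕ, Circuit (Fin n) → Prop}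
    (hε : ∀ n, ε n ≤ ε' n) (h : ∃ n₁ : ℕ, ∀ n ≥ n₁, ∀ C, P n C → Q n C) :
    PFamilyAE ε P ⊆ PFamilyAE ε' Q := by
  rintro L ⟨F, ⟨n₀, hn₀⟩, hL⟩
  obtain ⟨n₁, hn₁⟩ := h
  exact ⟨F, ⟨max n₀ n₁, fun n hn C hC =>
    hn₁ n (le_of_max_le_right hn) C (hn₀ n (le_of_max_le_left hn) C hC)⟩,
    fun x => (hL x).trans (hε _)⟩

/-- An every-length family class is contained in its almost-everywhere version. [folklore] -/
theorem setOf_family_subset_FamilyAE (P : ∀ n : ℕ, Circuit (Fin n) → Prop) :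
    {L | ∃ C : CircuitFamily, (∀ n, P n (C n)) ∧ C.Decides L} ⊆ FamilyAE P := by
  rintro L ⟨C, hC, hL⟩
  exact ⟨C, ⟨0, fun n _ => hC n⟩, hL⟩

/-- `SIZE s ⊆ SIZEae s`. [folklore] -/
theorem SIZE_subset_SIZEae (s : ℕ → ℕ) : SIZE s ⊆ SIZEae s :=
  fun _ hL => setOf_family_subset_FamilyAE (fun n C => C.IsOver B2 ∧ C.size ≤ s n) hL

/-- `SIZEae` is monotone in the (eventual) size bound. [folklore] -/
theorem SIZEae_mono {s s' : ℕ → ℕ} (h : ∃ n₁ : ℕ, ∀ n ≥ n₁, s n ≤ s' n) : SIZEae s ⊆ SIZEae s' := by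
  obtain ⟨n₁, hn₁⟩ := h
  exact FamilyAE_mono ⟨n₁, fun n hn C hC => ⟨hC.1, hC.2.trans (hn₁ n hn)⟩⟩

/-- `FORMULAae` is monotone in the (eventual) leaf-size bound. [folklore] -/
theorem FORMULAae_mono {s s' : ℕ → ℕ} (h : ∃ n₁ : ℕ, ∀ n ≥ n₁, s n ≤ s' n) :
    FORMULAae s ⊆ FORMULAae s' := by
  obtain ⟨n₁, hn₁⟩ := h
  exact FamilyAE_mono ⟨n₁, fun n hn C hC => ⟨hC.1, hC.2.1, hC.2.2.trans (hn₁ n hn)⟩⟩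

/-- `PFORMULAae` is monotone in the error and in the (eventual) leaf-size bound. [folklore] -/
theorem PFORMULAae_mono {ε ε' : ℕ → ℝ≥0∞} {s s' : ℕ → ℕ} (hε : ∀ n, ε n ≤ ε' n)
    (h : ∃ n₁ : ℕ, ∀ n ≥ n₁, s n ≤ s' n) : PFORMULAae ε s ⊆ PFORMULAae ε' s' := by
  obtain ⟨n₁, hn₁⟩ := h
  exact PFamilyAE_mono hε ⟨n₁, fun n hn C hC => ⟨hC.1, hC.2.1, hC.2.2.trans (hn₁ n hn)⟩⟩

/-- **Deterministic families are probabilistic families with any error** (Dirac distributions).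
[folklore] -/
theorem FamilyAE_subset_PFamilyAE (ε : ℕ → ℝ≥0∞) (P : ∀ n : ℕ, Circuit (Fin n) → Prop) :
    FamilyAE P ⊆ PFamilyAE ε P := by
  rintro L ⟨C, ⟨n₀, hn₀⟩, hL⟩
  refine ⟨fun n => PMF.pure (C n), ⟨n₀, fun n hn D hD => ?_⟩, fun x => ?_⟩
  · rw [PMF.support_pure, Set.mem_singleton_iff] at hD
    subst hD
    exact hn₀ n hn
  · have hx : C x.length ∉ {D : Circuit (Fin x.length) | D.eval x.get ≠ L.boolIndicator x} := by
      simp [hL x]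
    rw [PMF.toOuterMeasure_pure_apply, if_neg hx]
    exact bot_le

/-- `SIZEae`-style corollary: `FORMULAae s ⊆ PFORMULAae ε s` for every error `ε`. [folklore] -/
theorem FORMULAae_subset_PFORMULAae (ε : ℕ → ℝ≥0∞) (s : ℕ → ℕ) :
    FORMULAae s ⊆ PFORMULAae ε s :=
  FamilyAE_subset_PFamilyAE ε _

/-! ### Robustness under finitely many lengths -/

/-- Every Boolean function on `Fin n` is computed by some circuit (over `B₂`; Shannon expansion,
`cktSize_univ_fin`). [folklore] -/
theorem exists_circuit_eval_eq (n : ℕ) (f : (Fin n → Bool) → Bool) :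
    ∃ C : Circuit (Fin n), C.IsOver B2 ∧ ∀ x, C.eval x = f x := by
  obtain ⟨C, hB, -, hC⟩ := (cktSize_univ_fin n fun x _ => f x).toCircuit
  exact ⟨C, hB, hC⟩

/-- **Membership in `FamilyAE P` only depends on the language at all sufficiently large lengths**:
if `L ∈ FamilyAE P` and `L'` agrees with `L` on all strings of length `≥ m`, then `L' ∈ FamilyAE P`
(replace the first `m` circuits by circuits deciding the slices of `L'`; the constraint is only
required eventually). [folklore] -/
theorem FamilyAE.congr_eventually {P : ∀ n : ℕ, Circuit (Fin n) → Prop} {L L' : Language Bool}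
    (hL : L ∈ FamilyAE P) {m : ℕ} (h : ∀ x : List Bool, m ≤ x.length → (x ∈ L ↔ x ∈ L')) :
    L' ∈ FamilyAE P := by
  obtain ⟨C, ⟨n₀, hn₀⟩, hC⟩ := hL
  choose D hDB hD using fun n => exists_circuit_eval_eq n fun v => L'.boolIndicator (List.ofFn v)
  refine ⟨fun n => if n < m then D n else C n, ⟨max n₀ m, fun n hn => ?_⟩, fun x => ?_⟩
  · have hnm : ¬ n < m := not_lt.2 (le_of_max_le_right hn)
    simp only [hnm, if_false]
    exact hn₀ n (le_of_max_le_left hn)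
  · by_cases hx : x.length < m
    · simp only [hx, if_true, hD, List.ofFn_get]
    · simp only [hx, if_false, hC x]
      -- (`Complexity.boolIndicator_congr`, inlined to keep the import list small)
      rw [Bool.eq_iff_iff, ← Set.mem_iff_boolIndicator, ← Set.mem_iff_boolIndicator]
      exact h x (not_lt.1 hx)

/-- Probabilistic version of `FamilyAE.congr_eventually`: membership in `PFamilyAE ε P` only depends
on the language at all sufficiently large lengths. [folklore] -/
theorem PFamilyAE.congr_eventually {ε : ℕ → ℝ≥0∞} {P : ∀ n : ℕ, Circuit (Fin n) → Prop}
    {L L' : Language Bool} (hL : L ∈ PFamilyAE ε P) {m : ℕ}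
    (h : ∀ x : List Bool, m ≤ x.length → (x ∈ L ↔ x ∈ L')) : L' ∈ PFamilyAE ε P := by
  obtain ⟨F, ⟨n₀, hn₀⟩, hF⟩ := hL
  choose D hDB hD using fun n => exists_circuit_eval_eq n fun v => L'.boolIndicator (List.ofFn v)
  refine ⟨fun n => if n < m then PMF.pure (D n) else F n, ⟨max n₀ m, fun n hn C hC => ?_⟩,
    fun x => ?_⟩
  · have hnm : ¬ n < m := not_lt.2 (le_of_max_le_right hn)
    simp only [hnm, if_false] at hC
    exact hn₀ n (le_of_max_le_left hn) C hC
  · by_cases hx : x.length < m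
    · simp only [hx, if_true]
      have hx' : D x.length ∉ {C : Circuit (Fin x.length) | C.eval x.get ≠ L'.boolIndicator x} := by
        simp [hD, List.ofFn_get]
      rw [PMF.toOuterMeasure_pure_apply, if_neg hx']
      exact bot_le
    · simp only [hx, if_false]
      have hLL' : L.boolIndicator x = L'.boolIndicator x := by
        rw [Bool.eq_iff_iff, ← Set.mem_iff_boolIndicator, ← Set.mem_iff_boolIndicator]
        exact h x (not_lt.1 hx)
      rw [← hLL']
      exact hF x

/-! ### Non-vacuity -/

/-- The language of strings whose first bit is `1` (a one-leaf-formula language). [folklore] -/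
def headLang : Language Bool := {x | ∃ h : 0 < x.length, x.get ⟨0, h⟩ = true}

/-- The family deciding `headLang`: the constant-`0` circuit at length `0`, the one-leaf formula `x₀`
at positive lengths. [folklore] -/
def headFamily : CircuitFamily
  | 0 => Circuit.const (Fin 0) false
  | n + 1 => Circuit.input (0 : Fin (n + 1))

/-- `headFamily` decides `headLang`. [folklore] -/
theorem headFamily_decides : headFamily.Decides headLang := by
  intro x
  cases x with
  | nil => simp [headFamily, headLang, Set.boolIndicator]
  | cons b xs =>
    change (Circuit.input (0 : Fin (xs.length + 1))).eval (b :: xs).get = _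
    rw [Circuit.eval_input]
    unfold Set.boolIndicator headLang
    cases b <;> simp

/-- At positive lengths `headFamily n` is the one-leaf De Morgan formula `x₀`: over every basis, a
formula, `0` gates, leaf size `1`. [folklore] -/
theorem headFamily_succ_spec (B : Set GateFn) (n : ℕ) :
    (headFamily (n + 1)).IsOver B ∧ (headFamily (n + 1)).IsFormula ∧
      (headFamily (n + 1)).size = 0 ∧ (headFamily (n + 1)).leafSize = 1 :=
  ⟨Circuit.isOver_input B 0, (Circuit.isFormula_input (0 : Fin (n + 1))).1, Circuit.size_input 0,
    leafSize_input 0⟩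

/-- **Non-vacuity of `FamilyAE`**: if the constraint admits the one-leaf formula `x₀` at all large
lengths, `headLang ∈ FamilyAE P`. [folklore] -/
theorem headLang_mem_FamilyAE {P : ∀ n : ℕ, Circuit (Fin n) → Prop}
    (h : ∃ n₁ : ℕ, ∀ n ≥ n₁, P (n + 1) (Circuit.input (0 : Fin (n + 1)))) : headLang ∈ FamilyAE P := by
  obtain ⟨n₁, hn₁⟩ := h
  refine ⟨headFamily, ⟨n₁ + 1, fun n hn => ?_⟩, headFamily_decides⟩
  obtain ⟨k, rfl⟩ : ∃ k, n = k + 1 := ⟨n - 1, by omega⟩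
  exact hn₁ k (by omega)

/-- **`SIZEae s` is inhabited for every `s`** (`headLang`, `0` gates). [folklore] -/
theorem headLang_mem_SIZEae (s : ℕ → ℕ) : headLang ∈ SIZEae s :=
  headLang_mem_FamilyAE ⟨0, fun n _ => ⟨Circuit.isOver_input B2 0, by simp⟩⟩

/-- **`FORMULAae s` is inhabited as soon as `1 ≤ s n` eventually** (`headLang`, one leaf).
[folklore] -/
theorem headLang_mem_FORMULAae {s : ℕ → ℕ} (h : ∃ n₁ : ℕ, ∀ n ≥ n₁, 1 ≤ s n) :
    headLang ∈ FORMULAae s := by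
  obtain ⟨n₁, hn₁⟩ := h
  exact headLang_mem_FamilyAE ⟨n₁, fun n hn =>
    ⟨Circuit.isOver_input deMorganBasis 0, (Circuit.isFormula_input (0 : Fin (n + 1))).1,
      by rw [leafSize_input]; exact hn₁ (n + 1) (by omega)⟩⟩

/-- **`PFORMULAae ε s` is inhabited as soon as `1 ≤ s n` eventually**, for every error `ε`.
[folklore] -/
theorem headLang_mem_PFORMULAae (ε : ℕ → ℝ≥0∞) {s : ℕ → ℕ} (h : ∃ n₁ : ℕ, ∀ n ≥ n₁, 1 ≤ s n) :
    headLang ∈ PFORMULAae ε s :=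
  FORMULAae_subset_PFORMULAae ε s (headLang_mem_FORMULAae h)

end Literature.Computability.MetaComplexity
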